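import Summits.KontsevichZagierPeriods.KontsevichZagierPeriods.Theorems.RootDecompWalshStrataQuadricWalls04

/-!
# Root decomposition & Walsh strata — the elliptic-polar chart (gen 8 head start, §32)

GEN 8 MENU (3) of the node: for a fibre discriminant `D` whose quadratic part is POSITIVE
DEFINITE over `ℚ`, fibrewise Euler charts over `ℚ` may fail in every rational direction
(`D = 3x² + 3y² − 1`: the quadric `u² = D` has no rational point).  The device that replaces
them is the *elliptic-polar chart* with rational weights `κ₀ > 0`, `κ₁ ≥ 0`,
`Φ(t, r) = (r/N(t), r t/N(t))`, `N(t) = √(κ₀ + κ₁t²)`, `t ∈ ℝ`, `r > 0`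
(source coordinates `p 0 = t` = base, `p 1 = r` = fibre, so that bands in `r` over a `t`-base are
`oband`s): it is `ℚ`-semialgebraic, injective on `{r > 0}`, satisfies `κ₀X² + κ₁Y² = r²` and
`Y = X t` on its image `{X > 0}`, and `|det Φ′| = r/(κ₀ + κ₁t²)` is RATIONAL over `ℚ`.  Hence
(rule (2)) `[Φ(S), γ√(a(κ₀X² + κ₁Y²) + c)] ≡ [S, γ r √(a r² + c)/(κ₀ + κ₁t²)]`, a product weight
with the semialgebraic `r`-primitive `(γ/(3a))(a r² + c)^{3/2}/(κ₀ + κ₁t²)`.  The sector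
`{|Y| ≤ X}` is covered with `t ∈ [−1, 1]` by `(κ₀, κ₁) = (1, κ)`; the sectors `{|X| ≤ ±Y}` by the
same chart with `(κ₀, κ₁) = (κ, 1)` after the swap `X ↔ Y`; `X < 0` after `X ↦ −X`.

Contents: §32.1 the norm factor and its calculus; §32.2 the chart, Jacobian, injectivity, inverse,
image and semialgebraicity; §32.3 rule (2) for the chart (`pchart_sub_mem_relations`,
`InBaker.of_pchart`, `InBaker.to_pchart`); §32.4 the pulled-back weight (`InBaker.of_pchart_sqrt`).

This is part 1/5 (§32.1–32.4: the norm factor, the chart `pΦ`, its Jacobian / injectivity / inverse /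
semialgebraicity, rule (2) for the chart, the pulled-back weight); part 2/5
(`RootDecompWalshStrataPolarChart02`) = the `r`-primitive of the weight (input of `InBaker.of_planar_sections`)
and rational affine maps of the plane as moves (`AffMap`); part 3/5 = Lagrange normal form, chart domains, the engine on
them (`InBaker.of_psector`); part 4/5 = sector bookkeeping moves; part 5/5 = sections in height coordinates.  GEN 8 HEAD
START: nothing here is used by the
conditional assembly `quadricBakerDescent_of_sqrtDescentW`; these are the first typed moves toward its
hypothesis `hW` in the positive-definite case.
-/

noncomputable section

open Set MeasureTheory MvPolynomial Literature.NumberTheory.Transcendental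
open Literature.ModelTheory.ExponentialFields (IsSemialgebraic isSemialgebraic_univ)

namespace Summit.KontsevichZagierPeriods.RootDecompWalshStrata.ConicDescent.BallCube

/-! #### 32.1 The norm factor `N(t) = √(κ₀ + κ₁ t²)` -/

variable {κ₀ κ₁ : ℚ}

/-- `W(t) = κ₀ + κ₁ t²`. [this node] -/
def pW (κ₀ κ₁ : ℚ) (t : ℝ) : ℝ := κ₀ + κ₁ * t ^ 2

/-- `N(t) = √W(t)`. [this node] -/
def pN (κ₀ κ₁ : ℚ) (t : ℝ) : ℝ := √(pW κ₀ κ₁ t)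

/-- `1/N(t)`. [this node] -/
def pI (κ₀ κ₁ : ℚ) (t : ℝ) : ℝ := (pN κ₀ κ₁ t)⁻¹

/-- Auxiliary step `pW_pos`. [bookkeeping] -/
theorem pW_pos (hκ : 0 < κ₀ ∧ 0 ≤ κ₁) (t : ℝ) : 0 < pW κ₀ κ₁ t := by
  have h0 : (0 : ℝ) < κ₀ := by exact_mod_cast hκ.1
  have : (0 : ℝ) ≤ κ₁ * t ^ 2 := mul_nonneg (by exact_mod_cast hκ.2) (sq_nonneg t)
  unfold pW
  linarith

/-- Auxiliary step `pN_pos`. [bookkeeping] -/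
theorem pN_pos (hκ : 0 < κ₀ ∧ 0 ≤ κ₁) (t : ℝ) : 0 < pN κ₀ κ₁ t := Real.sqrt_pos.2 (pW_pos hκ t)

/-- Auxiliary step `pN_sq`. [bookkeeping] -/
theorem pN_sq (hκ : 0 < κ₀ ∧ 0 ≤ κ₁) (t : ℝ) : pN κ₀ κ₁ t ^ 2 = κ₀ + κ₁ * t ^ 2 :=
  Real.sq_sqrt (pW_pos hκ t).le

/-- Auxiliary step `pI_pos`. [bookkeeping] -/
theorem pI_pos (hκ : 0 < κ₀ ∧ 0 ≤ κ₁) (t : ℝ) : 0 < pI κ₀ κ₁ t := inv_pos.2 (pN_pos hκ t)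

/-- `(1/N)² = 1/W`. [this node] -/
theorem pI_sq (hκ : 0 < κ₀ ∧ 0 ≤ κ₁) (t : ℝ) : pI κ₀ κ₁ t ^ 2 = 1 / (κ₀ + κ₁ * t ^ 2) := by
  rw [pI, inv_pow, pN_sq hκ, one_div]

/-- `(1/N)²·W = 1`. [this node] -/
theorem pI_sq_mul (hκ : 0 < κ₀ ∧ 0 ≤ κ₁) (t : ℝ) : pI κ₀ κ₁ t ^ 2 * (κ₀ + κ₁ * t ^ 2) = 1 := by
  rw [pI_sq hκ]
  exact one_div_mul_cancel (pW_pos hκ t).ne'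

/-- Auxiliary step `hasDerivAt_pW`. [bookkeeping] -/
theorem hasDerivAt_pW (t : ℝ) : HasDerivAt (pW κ₀ κ₁) (2 * κ₁ * t) t := by
  have h := ((hasDerivAt_pow 2 t).const_mul (κ₁ : ℝ)).const_add (κ₀ : ℝ)
  have e : (2 : ℝ) * κ₁ * t = κ₁ * (((2 : ℕ) : ℝ) * t ^ (2 - 1)) := by
    push_cast
    ring
  rw [e]
  exact h

/-- `N′(t) = κ₁ t/N(t)`. [calculus] -/
theorem hasDerivAt_pN (hκ : 0 < κ₀ ∧ 0 ≤ κ₁) (t : ℝ) :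
    HasDerivAt (pN κ₀ κ₁) (κ₁ * t / pN κ₀ κ₁ t) t := by
  have h := (hasDerivAt_pW (κ₀ := κ₀) (κ₁ := κ₁) t).sqrt (pW_pos hκ t).ne'
  have e : (2 : ℝ) * κ₁ * t / (2 * √(pW κ₀ κ₁ t)) = κ₁ * t / pN κ₀ κ₁ t := by
    rw [show √(pW κ₀ κ₁ t) = pN κ₀ κ₁ t from rfl, mul_assoc, mul_div_mul_left _ _ (two_ne_zero' ℝ)]
  rw [e] at h
  exact h

/-- `(1/N)′ = −(N′/N²)`. [calculus] -/
theorem hasDerivAt_pI (hκ : 0 < κ₀ ∧ 0 ≤ κ₁) (t : ℝ) :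
    HasDerivAt (pI κ₀ κ₁) (-(κ₁ * t / pN κ₀ κ₁ t) / pN κ₀ κ₁ t ^ 2) t :=
  (hasDerivAt_pN hκ t).inv (pN_pos hκ t).ne'

/-- The derivative of `1/N` as `−κ₁ t·(1/N)³`. [this node] -/
def pI' (κ₀ κ₁ : ℚ) (t : ℝ) : ℝ := -(κ₁ * t) * pI κ₀ κ₁ t ^ 3

/-- Auxiliary step `pI_deriv_eq`. [bookkeeping] -/
theorem pI_deriv_eq (hκ : 0 < κ₀ ∧ 0 ≤ κ₁) (t : ℝ) :
    -((κ₁ : ℝ) * t / pN κ₀ κ₁ t) / pN κ₀ κ₁ t ^ 2 = pI' κ₀ κ₁ t := by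
  have hN : pN κ₀ κ₁ t ≠ 0 := (pN_pos hκ t).ne'
  rw [pI', pI, inv_pow]
  field_simp

/-- Auxiliary step `hasDerivAt_pI'`. [bookkeeping] -/
theorem hasDerivAt_pI' (hκ : 0 < κ₀ ∧ 0 ≤ κ₁) (t : ℝ) :
    HasDerivAt (pI κ₀ κ₁) (pI' κ₀ κ₁ t) t := by
  rw [← pI_deriv_eq hκ]
  exact hasDerivAt_pI hκ t

/-! #### 32.2 The chart `Φ(t, r) = (r/N(t), r t/N(t))` -/

/-- The elliptic-polar chart (source `p 0 = t`, `p 1 = r`; target `X`, `Y`). [this node] -/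
def pΦ (κ₀ κ₁ : ℚ) (p : Fin 2 → ℝ) : Fin 2 → ℝ :=
  ![p 1 * pI κ₀ κ₁ (p 0), p 1 * p 0 * pI κ₀ κ₁ (p 0)]

/-- Auxiliary step `pΦ_zero`. [bookkeeping] -/
@[simp] theorem pΦ_zero (p : Fin 2 → ℝ) : pΦ κ₀ κ₁ p 0 = p 1 * pI κ₀ κ₁ (p 0) := rfl
/-- Auxiliary step `pΦ_one`. [bookkeeping] -/
@[simp] theorem pΦ_one (p : Fin 2 → ℝ) : pΦ κ₀ κ₁ p 1 = p 1 * p 0 * pI κ₀ κ₁ (p 0) := rfl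

/-- `Y = X·t`. [this node] -/
theorem pΦ_one_eq (p : Fin 2 → ℝ) : pΦ κ₀ κ₁ p 1 = pΦ κ₀ κ₁ p 0 * p 0 := by
  simp only [pΦ_zero, pΦ_one]
  ring

/-- `κ₀X² + κ₁Y² = r²`. [this node] -/
theorem pΦ_sq_add (hκ : 0 < κ₀ ∧ 0 ≤ κ₁) (p : Fin 2 → ℝ) :
    (κ₀ : ℝ) * pΦ κ₀ κ₁ p 0 ^ 2 + κ₁ * pΦ κ₀ κ₁ p 1 ^ 2 = p 1 ^ 2 := by
  have h := pI_sq_mul hκ (p 0)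
  simp only [pΦ_zero, pΦ_one]
  linear_combination (p 1) ^ 2 * h

/-- `X > 0` for `r > 0`. [this node] -/
theorem pΦ_zero_pos (hκ : 0 < κ₀ ∧ 0 ≤ κ₁) {p : Fin 2 → ℝ} (hp : 0 < p 1) : 0 < pΦ κ₀ κ₁ p 0 :=
  mul_pos hp (pI_pos hκ _)

/-- Jacobian matrix of `Φ` (rows `X, Y`; columns `t, r`). [this node] -/
def pMat (κ₀ κ₁ : ℚ) (p : Fin 2 → ℝ) : Matrix (Fin 2) (Fin 2) ℝ :=
  !![p 1 * pI' κ₀ κ₁ (p 0), pI κ₀ κ₁ (p 0);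
     p 1 * (pI κ₀ κ₁ (p 0) + p 0 * pI' κ₀ κ₁ (p 0)), p 0 * pI κ₀ κ₁ (p 0)]

/-- The derivative of `Φ` at `p` as a continuous linear map. [this node] -/
def pΦ' (κ₀ κ₁ : ℚ) (p : Fin 2 → ℝ) : (Fin 2 → ℝ) →L[ℝ] (Fin 2 → ℝ) :=
  LinearMap.toContinuousLinearMap (Matrix.toLin' (pMat κ₀ κ₁ p))

/-- Auxiliary step `pΦ'_apply`. [bookkeeping] -/
theorem pΦ'_apply (p v : Fin 2 → ℝ) (a : Fin 2) :
    pΦ' κ₀ κ₁ p v a = ∑ b, pMat κ₀ κ₁ p a b * v b := by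
  change Matrix.toLin' (pMat κ₀ κ₁ p) v a = _
  rw [Matrix.toLin'_apply]
  rfl

/-- `det Φ′(t, r) = −r·(1/N)²`. [this node] -/
theorem pΦ'_det (p : Fin 2 → ℝ) : (pΦ' κ₀ κ₁ p).det = -(p 1 * pI κ₀ κ₁ (p 0) ^ 2) := by
  change LinearMap.det (Matrix.toLin' (pMat κ₀ κ₁ p)) = _
  rw [LinearMap.det_toLin', Matrix.det_fin_two]
  simp only [pMat, Matrix.of_apply, Matrix.cons_val', Matrix.cons_val_zero, Matrix.cons_val_one,
    Matrix.cons_val_fin_one, Matrix.empty_val']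
  ring

/-- `|det Φ′(t, r)| = r/(κ₀ + κ₁t²)` for `r > 0` — RATIONAL. [this node] -/
theorem abs_pΦ'_det (hκ : 0 < κ₀ ∧ 0 ≤ κ₁) {p : Fin 2 → ℝ} (hp : 0 < p 1) :
    |(pΦ' κ₀ κ₁ p).det| = p 1 / (κ₀ + κ₁ * p 0 ^ 2) := by
  rw [pΦ'_det, abs_neg, pI_sq hκ, mul_one_div]
  exact abs_of_pos (div_pos hp (pW_pos hκ (p 0)))

/-- `Φ` is differentiable everywhere with derivative `Φ′`. [calculus] -/
theorem hasFDerivAt_pΦ (hκ : 0 < κ₀ ∧ 0 ≤ κ₁) (p : Fin 2 → ℝ) :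
    HasFDerivAt (pΦ κ₀ κ₁) (pΦ' κ₀ κ₁ p) p := by
  have hπ0 : HasFDerivAt (𝕜 := ℝ) (fun y : Fin 2 → ℝ => y 0)
      (ContinuousLinearMap.proj (R := ℝ) (φ := fun _ : Fin 2 => ℝ) 0) p := hasFDerivAt_apply 0 p
  have hπ1 : HasFDerivAt (𝕜 := ℝ) (fun y : Fin 2 → ℝ => y 1)
      (ContinuousLinearMap.proj (R := ℝ) (φ := fun _ : Fin 2 => ℝ) 1) p := hasFDerivAt_apply 1 p
  have hI : HasFDerivAt (fun y : Fin 2 → ℝ => pI κ₀ κ₁ (y 0))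
      ((pI' κ₀ κ₁ (p 0)) • ContinuousLinearMap.proj (R := ℝ) (φ := fun _ : Fin 2 => ℝ) 0) p :=
    HasDerivAt.comp_hasFDerivAt (h₂ := pI κ₀ κ₁) p (hasDerivAt_pI' hκ (p 0)) hπ0
  have h0 : HasFDerivAt (fun y : Fin 2 → ℝ => pΦ κ₀ κ₁ y 0)
      ((ContinuousLinearMap.proj 0).comp (pΦ' κ₀ κ₁ p)) p := by
    have hf : (fun y : Fin 2 → ℝ => pΦ κ₀ κ₁ y 0) = fun y => y 1 * pI κ₀ κ₁ (y 0) :=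
      funext pΦ_zero
    rw [hf]
    refine (hπ1.mul hI).congr_fderiv (ContinuousLinearMap.ext fun v => ?_)
    simp [pΦ'_apply, pMat, Fin.sum_univ_two, smul_eq_mul]
    ring
  have h1 : HasFDerivAt (fun y : Fin 2 → ℝ => pΦ κ₀ κ₁ y 1)
      ((ContinuousLinearMap.proj 1).comp (pΦ' κ₀ κ₁ p)) p := by
    have hf : (fun y : Fin 2 → ℝ => pΦ κ₀ κ₁ y 1) = fun y => y 1 * y 0 * pI κ₀ κ₁ (y 0) :=
      funext pΦ_one
    rw [hf]
    refine ((hπ1.mul hπ0).mul hI).congr_fderiv (ContinuousLinearMap.ext fun v => ?_)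
    simp [pΦ'_apply, pMat, Fin.sum_univ_two, smul_eq_mul]
    ring
  refine hasFDerivAt_pi'' fun a => ?_
  fin_cases a
  · exact h0
  · exact h1

/-- `Φ` is injective on `{r > 0}`. [this node] -/
theorem injOn_pΦ (hκ : 0 < κ₀ ∧ 0 ≤ κ₁) : InjOn (pΦ κ₀ κ₁) {p | 0 < p 1} := by
  intro p hp q hq hpq
  have hp1 : 0 < p 1 := hp
  have hX : p 1 * pI κ₀ κ₁ (p 0) = q 1 * pI κ₀ κ₁ (q 0) := by simpa using congrFun hpq 0
  have hY : p 1 * p 0 * pI κ₀ κ₁ (p 0) = q 1 * q 0 * pI κ₀ κ₁ (q 0) := by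
    simpa using congrFun hpq 1
  have hXp : 0 < p 1 * pI κ₀ κ₁ (p 0) := mul_pos hp1 (pI_pos hκ _)
  have ht : p 0 = q 0 := by
    have e : p 1 * pI κ₀ κ₁ (p 0) * p 0 = p 1 * pI κ₀ κ₁ (p 0) * q 0 := by
      calc p 1 * pI κ₀ κ₁ (p 0) * p 0 = p 1 * p 0 * pI κ₀ κ₁ (p 0) := by ring
        _ = q 1 * q 0 * pI κ₀ κ₁ (q 0) := hY
        _ = q 1 * pI κ₀ κ₁ (q 0) * q 0 := by ring
        _ = p 1 * pI κ₀ κ₁ (p 0) * q 0 := by rw [hX]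
    exact mul_left_cancel₀ hXp.ne' e
  rw [ht] at hX
  have hr : p 1 = q 1 := mul_right_cancel₀ (pI_pos hκ (q 0)).ne' hX
  funext j
  fin_cases j
  · exact ht
  · exact hr

/-- The inverse chart `Ψ(X, Y) = (Y/X, √(κ₀X² + κ₁Y²))` on `X > 0`. [this node] -/
def pΨ (κ₀ κ₁ : ℚ) (w : Fin 2 → ℝ) : Fin 2 → ℝ := ![w 1 / w 0, √(κ₀ * w 0 ^ 2 + κ₁ * w 1 ^ 2)]

/-- Auxiliary step `pΨ_zero`. [bookkeeping] -/
@[simp] theorem pΨ_zero (w : Fin 2 → ℝ) : pΨ κ₀ κ₁ w 0 = w 1 / w 0 := rfl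
/-- Auxiliary step `pΨ_one`. [bookkeeping] -/
@[simp] theorem pΨ_one (w : Fin 2 → ℝ) : pΨ κ₀ κ₁ w 1 = √(κ₀ * w 0 ^ 2 + κ₁ * w 1 ^ 2) := rfl

/-- `Ψ ∘ Φ = id` on `r > 0`. [this node] -/
theorem pΨ_pΦ (hκ : 0 < κ₀ ∧ 0 ≤ κ₁) {p : Fin 2 → ℝ} (hp : 0 < p 1) : pΨ κ₀ κ₁ (pΦ κ₀ κ₁ p) = p := by
  have hXp : 0 < p 1 * pI κ₀ κ₁ (p 0) := mul_pos hp (pI_pos hκ _)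
  funext j
  fin_cases j
  · show pΦ κ₀ κ₁ p 1 / pΦ κ₀ κ₁ p 0 = p 0
    rw [pΦ_one_eq, pΦ_zero, mul_div_cancel_left₀ _ hXp.ne']
  · show √(κ₀ * pΦ κ₀ κ₁ p 0 ^ 2 + κ₁ * pΦ κ₀ κ₁ p 1 ^ 2) = p 1
    rw [pΦ_sq_add hκ, Real.sqrt_sq hp.le]

/-- `Φ ∘ Ψ = id` on `X > 0`. [this node] -/
theorem pΦ_pΨ (hκ : 0 < κ₀ ∧ 0 ≤ κ₁) {w : Fin 2 → ℝ} (hw : 0 < w 0) : pΦ κ₀ κ₁ (pΨ κ₀ κ₁ w) = w := by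
  have h0 : (0 : ℝ) < κ₀ := by exact_mod_cast hκ.1
  have hq : 0 < (κ₀ : ℝ) * w 0 ^ 2 + κ₁ * w 1 ^ 2 := by
    have : (0 : ℝ) ≤ κ₁ * w 1 ^ 2 := mul_nonneg (by exact_mod_cast hκ.2) (sq_nonneg _)
    positivity
  have ht : (κ₀ : ℝ) + κ₁ * (w 1 / w 0) ^ 2 = (κ₀ * w 0 ^ 2 + κ₁ * w 1 ^ 2) / w 0 ^ 2 := by
    field_simp
  have hN : pN κ₀ κ₁ (w 1 / w 0) = √(κ₀ * w 0 ^ 2 + κ₁ * w 1 ^ 2) / w 0 := by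
    rw [pN, pW, ht, Real.sqrt_div' _ (sq_nonneg _), Real.sqrt_sq hw.le]
  have hS : √((κ₀ : ℝ) * w 0 ^ 2 + κ₁ * w 1 ^ 2) ≠ 0 := (Real.sqrt_pos.2 hq).ne'
  have hI : pI κ₀ κ₁ (w 1 / w 0) = w 0 / √(κ₀ * w 0 ^ 2 + κ₁ * w 1 ^ 2) := by
    rw [pI, hN, inv_div]
  funext j
  fin_cases j
  · show pΨ κ₀ κ₁ w 1 * pI κ₀ κ₁ (pΨ κ₀ κ₁ w 0) = w 0
    rw [pΨ_zero, pΨ_one, hI, mul_div_cancel₀ _ hS]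
  · show pΨ κ₀ κ₁ w 1 * pΨ κ₀ κ₁ w 0 * pI κ₀ κ₁ (pΨ κ₀ κ₁ w 0) = w 1
    rw [pΨ_zero, pΨ_one, hI]
    field_simp

/-- The image of a set `S ⊆ {r > 0}` under `Φ`. [this node] -/
theorem image_pΦ (hκ : 0 < κ₀ ∧ 0 ≤ κ₁) {S : Set (Fin 2 → ℝ)} (hS : S ⊆ {p | 0 < p 1}) :
    pΦ κ₀ κ₁ '' S = {w | 0 < w 0 ∧ pΨ κ₀ κ₁ w ∈ S} := by
  ext w
  constructor
  · rintro ⟨p, hp, rfl⟩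
    exact ⟨pΦ_zero_pos hκ (hS hp), by rwa [pΨ_pΦ hκ (hS hp)]⟩
  · rintro ⟨hw, hm⟩
    exact ⟨pΨ κ₀ κ₁ w, hm, pΦ_pΨ hκ hw⟩

/-- `Φ` is a `ℚ`-semialgebraic map on every `ℚ`-semialgebraic set. [BCR1998 §2.2] -/
theorem isSemialgebraicMapOn_pΦ (hκ : 0 < κ₀ ∧ 0 ≤ κ₁) {S : Set (Fin 2 → ℝ)}
    (hS : IsSemialgebraic ℚ S) : IsSemialgebraicMapOn ℚ S (pΦ κ₀ κ₁) := by
  have hNf : IsSemialgebraicFunOn ℚ S fun p => pN κ₀ κ₁ (p 0) :=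
    (IsSemialgebraicFunOn.sqrt_holds
      (isSemialgebraicFunOn_aeval hS (C κ₀ + C κ₁ * X 0 ^ 2 : MvPolynomial (Fin 2) ℚ))).congr
      fun p _ => by simp [pN, pW]
  have hN0 : ∀ p ∈ S, pN κ₀ κ₁ (p 0) ≠ 0 := fun p _ => (pN_pos hκ _).ne'
  refine IsSemialgebraicMapOn.of_forall hS fun j => ?_
  fin_cases j
  · exact ((isSemialgebraicFunOn_aeval hS (X 1 : MvPolynomial (Fin 2) ℚ)).div hNf hN0).congr
      fun p _ => by simp [pI, div_eq_mul_inv]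
  · exact ((isSemialgebraicFunOn_aeval hS (X 1 * X 0 : MvPolynomial (Fin 2) ℚ)).div hNf hN0).congr
      fun p _ => by simp [pI, div_eq_mul_inv]

/-! #### 32.3 Rule (2) for the chart -/

/-- **The elliptic-polar chart as one move of rule (2).**  If `ρ.domain ⊆ {r > 0}`,
`σ.domain = Φ(ρ.domain)` and `ρ.integrand = (σ.integrand ∘ Φ)·r/(κ₀ + κ₁t²)` on `ρ.domain`,
then `[ρ] − [σ]` is a relation. [KontsevichZagier2001 §1.2 rule (2); this node] -/
theorem pchart_sub_mem_relations (hκ : 0 < κ₀ ∧ 0 ≤ κ₁) (ρ σ : KZ.IntegralRep 2)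
    (hρ : ρ.domain ⊆ {p | 0 < p 1}) (hσ : σ.domain = pΦ κ₀ κ₁ '' ρ.domain)
    (hf : ∀ p ∈ ρ.domain,
      ρ.integrand p = σ.integrand (pΦ κ₀ κ₁ p) * (p 1 / (κ₀ + κ₁ * p 0 ^ 2))) :
    KZ.of ρ - KZ.of σ ∈ KZ.relations := by
  refine KZ.changeOfVariablesRel_subset_relations ⟨2, ρ, σ, pΦ κ₀ κ₁, pΦ' κ₀ κ₁,
    isSemialgebraicMapOn_pΦ hκ ρ.isSemialgebraic_domain,
    fun p _ => (hasFDerivAt_pΦ hκ p).hasFDerivWithinAt, (injOn_pΦ hκ).mono hρ, hσ, ?_, rfl⟩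
  intro p hp
  rw [hf p hp, abs_pΦ'_det hκ (hρ hp)]

/-- Transfer along the chart: `[ρ]` in the Baker sector modulo relations ⇒ `[σ]` is.
[this node] -/
theorem InBaker.of_pchart (hκ : 0 < κ₀ ∧ 0 ≤ κ₁) (ρ σ : KZ.IntegralRep 2)
    (hρ : ρ.domain ⊆ {p | 0 < p 1}) (hσ : σ.domain = pΦ κ₀ κ₁ '' ρ.domain)
    (hf : ∀ p ∈ ρ.domain,
      ρ.integrand p = σ.integrand (pΦ κ₀ κ₁ p) * (p 1 / (κ₀ + κ₁ * p 0 ^ 2)))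
    (h : InBaker (KZ.of ρ)) : InBaker (KZ.of σ) := by
  refine h.congr ?_
  rw [← neg_sub]
  exact KZ.relations.neg_mem (pchart_sub_mem_relations hκ ρ σ hρ hσ hf)

/-- Transfer back: `[σ]` in the Baker sector modulo relations ⇒ `[ρ]` is. [this node] -/
theorem InBaker.to_pchart (hκ : 0 < κ₀ ∧ 0 ≤ κ₁) (ρ σ : KZ.IntegralRep 2)
    (hρ : ρ.domain ⊆ {p | 0 < p 1}) (hσ : σ.domain = pΦ κ₀ κ₁ '' ρ.domain)
    (hf : ∀ p ∈ ρ.domain,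
      ρ.integrand p = σ.integrand (pΦ κ₀ κ₁ p) * (p 1 / (κ₀ + κ₁ * p 0 ^ 2)))
    (h : InBaker (KZ.of σ)) : InBaker (KZ.of ρ) :=
  h.congr (pchart_sub_mem_relations hκ ρ σ hρ hσ hf)

/-! #### 32.4 The pulled-back weight `γ√(a(κ₀X² + κ₁Y²) + c)∘Φ · |det Φ′| = γ r √(a r² + c)/W(t)` -/

/-- The normalised discriminant `a(κ₀X² + κ₁Y²) + c` pulls back to `a r² + c`. [this node] -/
theorem normD_pΦ (hκ : 0 < κ₀ ∧ 0 ≤ κ₁) (a c : ℚ) (p : Fin 2 → ℝ) :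
    (a : ℝ) * (κ₀ * pΦ κ₀ κ₁ p 0 ^ 2 + κ₁ * pΦ κ₀ κ₁ p 1 ^ 2) + c = a * p 1 ^ 2 + c := by
  rw [pΦ_sq_add hκ]

/-- The pulled-back weight. [this node] -/
def pweight (κ₀ κ₁ γ a c : ℚ) (p : Fin 2 → ℝ) : ℝ :=
  (γ : ℝ) * p 1 * √(a * p 1 ^ 2 + c) / (κ₀ + κ₁ * p 0 ^ 2)

/-- The weight identity of the chart. [this node] -/
theorem weight_pΦ (hκ : 0 < κ₀ ∧ 0 ≤ κ₁) (γ a c : ℚ) (p : Fin 2 → ℝ) :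
    (γ : ℝ) * √(a * (κ₀ * pΦ κ₀ κ₁ p 0 ^ 2 + κ₁ * pΦ κ₀ κ₁ p 1 ^ 2) + c) *
        (p 1 / (κ₀ + κ₁ * p 0 ^ 2)) = pweight κ₀ κ₁ γ a c p := by
  rw [normD_pΦ hκ, pweight]
  ring

/-- The pulled-back weight is `ℚ`-semialgebraic. [BCR1998 §2.2] -/
theorem isSemialgebraicFunOn_pweight (hκ : 0 < κ₀ ∧ 0 ≤ κ₁) {S : Set (Fin 2 → ℝ)}
    (hS : IsSemialgebraic ℚ S) (γ a c : ℚ) : IsSemialgebraicFunOn ℚ S (pweight κ₀ κ₁ γ a c) := by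
  have hnum : IsSemialgebraicFunOn ℚ S fun p => (γ : ℝ) * p 1 * √(a * p 1 ^ 2 + c) :=
    ((isSemialgebraicFunOn_aeval hS (C γ * X 1 : MvPolynomial (Fin 2) ℚ)).mul_holds
      (IsSemialgebraicFunOn.sqrt_holds
        (isSemialgebraicFunOn_aeval hS (C a * X 1 ^ 2 + C c : MvPolynomial (Fin 2) ℚ)))).congr
      fun p _ => by simp
  have hden : IsSemialgebraicFunOn ℚ S fun p => (κ₀ : ℝ) + κ₁ * p 0 ^ 2 :=
    (isSemialgebraicFunOn_aeval hS (C κ₀ + C κ₁ * X 0 ^ 2 : MvPolynomial (Fin 2) ℚ)).congr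
      fun p _ => by simp
  exact (hnum.div hden fun p _ => (pW_pos hκ (p 0)).ne').congr fun p _ => by simp only [pweight]

/-- A bound for the pulled-back weight on `0 < r ≤ 1`: `|w| ≤ |γ|·√(|a| + |c|)/κ₀`. [this node] -/
theorem abs_pweight_le (hκ : 0 < κ₀ ∧ 0 ≤ κ₁) (γ a c : ℚ) {p : Fin 2 → ℝ} (h0 : 0 ≤ p 1)
    (h1 : p 1 ≤ 1) : |pweight κ₀ κ₁ γ a c p| ≤ |(γ : ℝ)| * √(|(a : ℝ)| + |(c : ℝ)|) / κ₀ := by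
  have hk0 : (0 : ℝ) < κ₀ := by exact_mod_cast hκ.1
  have hW : (κ₀ : ℝ) ≤ κ₀ + κ₁ * p 0 ^ 2 :=
    le_add_of_nonneg_right (mul_nonneg (by exact_mod_cast hκ.2) (sq_nonneg _))
  have hWp : (0 : ℝ) < κ₀ + κ₁ * p 0 ^ 2 := hk0.trans_le hW
  have hs : √((a : ℝ) * p 1 ^ 2 + c) ≤ √(|(a : ℝ)| + |(c : ℝ)|) := by
    refine Real.sqrt_le_sqrt ((le_abs_self _).trans ((abs_add_le _ _).trans (add_le_add ?_ le_rfl)))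
    rw [abs_mul, abs_of_nonneg (sq_nonneg (p 1))]
    exact mul_le_of_le_one_right (abs_nonneg _) (by nlinarith)
  rw [pweight, abs_div, abs_of_pos hWp, abs_mul, abs_mul, abs_of_nonneg h0,
    abs_of_nonneg (Real.sqrt_nonneg _)]
  have hn : |(γ : ℝ)| * p 1 * √(a * p 1 ^ 2 + c) ≤ |(γ : ℝ)| * √(|(a : ℝ)| + |(c : ℝ)|) := by
    calc |(γ : ℝ)| * p 1 * √(a * p 1 ^ 2 + c) ≤ |(γ : ℝ)| * 1 * √(|(a : ℝ)| + |(c : ℝ)|) :=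
          mul_le_mul (mul_le_mul_of_nonneg_left h1 (abs_nonneg _)) hs (Real.sqrt_nonneg _)
            (by positivity)
      _ = _ := by ring
  exact div_le_div₀ (by positivity) hn hk0 hW

/-- **The chart move for `γ√D`, `D = a(κ₀X² + κ₁Y²) + c`.**  For a source representation on
`S ⊆ {r > 0}` with the product weight `γ r √(a r² + c)/(κ₀ + κ₁t²)` and a target representation
on `Φ(S)` with weight `γ√(a(κ₀X² + κ₁Y²) + c)`: the target is in the Baker sector modulo
relations as soon as the source is. [KontsevichZagier2001 §1.2 rule (2); this node] -/
theorem InBaker.of_pchart_sqrt (hκ : 0 < κ₀ ∧ 0 ≤ κ₁) (γ a c : ℚ) (ρ σ : KZ.IntegralRep 2)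
    (hρ : ρ.domain ⊆ {p | 0 < p 1}) (hσ : σ.domain = pΦ κ₀ κ₁ '' ρ.domain)
    (hρi : ∀ p ∈ ρ.domain, ρ.integrand p = pweight κ₀ κ₁ γ a c p)
    (hσi : ∀ w ∈ σ.domain,
      σ.integrand w = (γ : ℝ) * √(a * (κ₀ * w 0 ^ 2 + κ₁ * w 1 ^ 2) + c))
    (h : InBaker (KZ.of ρ)) : InBaker (KZ.of σ) := by
  refine InBaker.of_pchart hκ ρ σ hρ hσ (fun p hp => ?_) h
  rw [hρi p hp, hσi _ (hσ ▸ mem_image_of_mem _ hp), weight_pΦ hκ]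

end Summit.KontsevichZagierPeriods.RootDecompWalshStrata.ConicDescent.BallCube
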